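import Literature.Analysis.ODE.TwoPointDampingGronwall
import Literature.Analysis.ODE.IntegralGronwall
import Mathlib.MeasureTheory.Integral.DominatedConvergence
import Mathlib.Analysis.SpecialFunctions.Sqrt
import HarnessLib

/-!
# Two-scale (slow/fast) leakage: a Grönwall lemma for a conservative exchange between a slow and a damped fast energy

Topic `Literature/Analysis/ODE` (namespace `Literature.Analysis.ODE`).  Real-variable proof support (everything proved).
Two nonnegative "energies" `p` (slow) and `q` (fast), known only on a set `S ⊆ (0,T)` of full measure, exchange through a flux `φ`:
`p(t) ≤ ∫_{(0,t]} φ` (the slow block starts empty and is fed only by the flux), `q(t) − q(s) ≤ ∫_{(s,t]} (−φ − λ q)`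
(the fast block loses the same flux and is damped at rate `λ`), `q(0) = q₀`, with the bilinear bound `|φ| ≤ 2η √(p q)`.
Then the slow energy obeys `p(t) ≤ 64 (η/λ)² e^{8η² t/λ} q₀` (`slow_le_of_two_scale_exchange`).

Why the prefactor `(η/λ)²` (and not `1`): the fast energy decays in time `1/λ` while the slow amplitude `√p` grows at speed
`≤ 2η√q`; the transient therefore deposits `√p ≲ η√q₀/λ`, after which the slaved regime `q ≲ (η/λ)² p` only allows the slow
growth rate `η²/λ`.  This is the integral (absolutely-continuous-free) form of the comparison principle for the cooperative
system `X' ≤ 2ηY`, `Y' ≤ −λY + 2ηX` (Perron root `≤ 4η²/λ`), in the form delivered by the Galerkin energy identities of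
weak solutions: a running supremum of `p` turns the `q`-inequality into one with a constant source, the exponential-envelope
two-point Grönwall lemma (`le_envelope_of_two_point_setIntegral_le`) gives `q ≤ 4η²P/λ² + q₀e^{−λt/2}`, and the
Grönwall–Bellman lemma (`gronwall_integral_le_on`) closes on the continuous primitive of the running supremum.
Consumer: clause (F_T) (window-local slow leakage of fluctuation data) of the K1L tensor cell package
(`CellEnergyClausesWNoE`, stub `stub_cellEnergyT` of `LagrangianRenormalisationStep`, cell `ad-ideate`).

## References

* L. C. Evans, *Partial Differential Equations*, 2nd ed. (AMS 2010), App. B.2 (Grönwall's inequality). [`Evans2010`]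
* J. C. Robinson, J. L. Rodrigo, W. Sadowski, *The three-dimensional Navier–Stokes equations* (CUP 2016), §4.2. [`RobinsonRodrigoSadowski2016`]
-/

noncomputable section

open MeasureTheory Set Filter

namespace Literature.Analysis.ODE

/-- `2η√(xy) ≤ (λ/2)·y + (2η²/λ)·x` for `x, y ≥ 0`, `λ > 0` (weighted AM–GM). [cite: Evans2010, App. B.2 (Grönwall's inequality)] -/
theorem two_mul_sqrt_mul_le {η lam x y : ℝ} (hη : 0 ≤ η) (hlam : 0 < lam) (hx : 0 ≤ x) (hy : 0 ≤ y) :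
    2 * η * Real.sqrt (x * y) ≤ lam / 2 * y + 2 * η ^ 2 / lam * x := by
  have hs : Real.sqrt (x * y) ^ 2 = x * y := Real.sq_sqrt (mul_nonneg hx hy)
  have hs0 : 0 ≤ Real.sqrt (x * y) := Real.sqrt_nonneg _
  have hA : 0 ≤ lam / 2 * y := by positivity
  have hB : 0 ≤ 2 * η ^ 2 / lam * x := by positivity
  -- `(2η s)² = 4η² xy = 4·(λ/2 y)(2η²/λ x) ≤ (λ/2 y + 2η²/λ x)²`
  have hprod : 4 * (lam / 2 * y) * (2 * η ^ 2 / lam * x) = (2 * η * Real.sqrt (x * y)) ^ 2 := by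
    rw [mul_pow, hs]
    field_simp
    ring
  have hsq : (2 * η * Real.sqrt (x * y)) ^ 2 ≤ (lam / 2 * y + 2 * η ^ 2 / lam * x) ^ 2 := by
    nlinarith [sq_nonneg (lam / 2 * y - 2 * η ^ 2 / lam * x)]
  have h2 : 0 ≤ 2 * η * Real.sqrt (x * y) := by positivity
  exact (pow_le_pow_iff_left₀ h2 (add_nonneg hA hB) two_ne_zero).1 hsq

/-- `√v ≤ a + b` when `v ≤ a² + b²` and `a, b ≥ 0`. [cite: Evans2010, App. B.2 (Grönwall's inequality)] -/
theorem sqrt_le_add_of_le_sq_add_sq {v a b : ℝ} (ha : 0 ≤ a) (hb : 0 ≤ b) (h : v ≤ a ^ 2 + b ^ 2) :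
    Real.sqrt v ≤ a + b := by
  have h' : v ≤ (a + b) ^ 2 := by nlinarith [mul_nonneg ha hb]
  calc Real.sqrt v ≤ Real.sqrt ((a + b) ^ 2) := Real.sqrt_le_sqrt h'
    _ = a + b := Real.sqrt_sq (add_nonneg ha hb)

/-- `∫_{(0,t]} e^{−(λ/4) x} dx ≤ 4/λ` (`λ > 0`, `t ≥ 0`). [cite: Evans2010, App. B.2 (Grönwall's inequality)] -/
theorem setIntegral_Ioc_exp_neg_quarter_le {lam t : ℝ} (hlam : 0 < lam) (ht : 0 ≤ t) :
    ∫ x in Ioc 0 t, Real.exp (-(lam / 4) * x) ≤ 4 / lam := by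
  have e : ∀ x, Real.exp (-(lam / 4) * x) = -((lam / 4) * (-(4 / lam)) * Real.exp (-(lam / 4) * x)) := by
    intro x
    have : (lam / 4) * (-(4 / lam)) = -1 := by field_simp
    rw [this]
    ring
  rw [setIntegral_congr_fun measurableSet_Ioc (fun x _ => e x), setIntegral_Ioc_neg_mul_exp ht]
  have h0 : Real.exp (-(lam / 4) * 0) = 1 := by simp
  rw [h0]
  have hpos : 0 < Real.exp (-(lam / 4) * t) := Real.exp_pos _
  have h4 : 0 < 4 / lam := by positivity
  nlinarith

/-- **Slow leakage under a conservative slow/fast exchange (two-scale Grönwall, a.e. integral form).**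
Let `S ⊆ (0,T)` have full measure and let `p, q ≥ 0` on `S` with `p ≤ B` on `S`, `q, φ` integrable on `(0,T)`.  Suppose
`|φ| ≤ 2η√(p q)` a.e., `p(t) ≤ ∫_{(0,t]} φ` and `q(t) − q₀ ≤ ∫_{(0,t]} (−φ − λq)` for `t ∈ S`, and
`q(t) − q(s) ≤ ∫_{(s,t]} (−φ − λq)` for `s ≤ t` in `S` (`η, q₀, B ≥ 0`, `λ > 0`; `T` is only the ambient window).  Then for every `t ∈ S`
`p(t) ≤ 64 (η²/λ²) · e^{8 (η²/λ) t} · q₀`.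
[cite: Evans2010, App. B.2 (Grönwall's inequality)] [cite: RobinsonRodrigoSadowski2016, §4.2 (4.20)] -/
theorem slow_le_of_two_scale_exchange {p q φ : ℝ → ℝ} {S : Set ℝ} {T η lam q₀ B : ℝ}
    (hη : 0 ≤ η) (hlam : 0 < lam) (hq₀ : 0 ≤ q₀) (hB : 0 ≤ B)
    (hSsub : S ⊆ Ioo 0 T) (hS : ∀ᵐ r ∂(volume.restrict (Ioo 0 T)), r ∈ S)
    (hp0 : ∀ r ∈ S, 0 ≤ p r) (hpB : ∀ r ∈ S, p r ≤ B) (hq0 : ∀ r ∈ S, 0 ≤ q r)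
    (hqi : IntegrableOn q (Ioo 0 T)) (hφi : IntegrableOn φ (Ioo 0 T))
    (hφ : ∀ᵐ r ∂(volume.restrict (Ioo 0 T)), |φ r| ≤ 2 * η * Real.sqrt (p r * q r))
    (hp : ∀ t ∈ S, p t ≤ ∫ r in Ioc 0 t, φ r)
    (hqinit : ∀ t ∈ S, q t - q₀ ≤ ∫ r in Ioc 0 t, (-φ r - lam * q r))
    (hq2 : ∀ s ∈ S, ∀ t ∈ S, s ≤ t → q t - q s ≤ ∫ r in Ioc s t, (-φ r - lam * q r)) :
    ∀ t ∈ S, p t ≤ 64 * η ^ 2 / lam ^ 2 * Real.exp (8 * η ^ 2 / lam * t) * q₀ := by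
  -- a.e. statements transferred to `volume`
  have hS' : ∀ᵐ r ∂(volume : Measure ℝ), r ∈ Ioo 0 T → r ∈ S := (ae_restrict_iff' measurableSet_Ioo).1 hS
  have hφ' : ∀ᵐ r ∂(volume : Measure ℝ), r ∈ Ioo 0 T → |φ r| ≤ 2 * η * Real.sqrt (p r * q r) :=
    (ae_restrict_iff' measurableSet_Ioo).1 hφ
  -- ### the running supremum of `p` over the good set
  obtain ⟨P, hPdef⟩ : ∃ P : ℝ → ℝ, P = fun t => sSup (p '' {r | r ∈ S ∧ r ≤ t}) := ⟨_, rfl⟩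
  have hbdd : ∀ t, BddAbove (p '' {r | r ∈ S ∧ r ≤ t}) := fun t =>
    ⟨B, by rintro _ ⟨r, hr, rfl⟩; exact hpB r hr.1⟩
  have hle_P : ∀ t, ∀ r ∈ S, r ≤ t → p r ≤ P t := fun t r hr hrt => by
    rw [hPdef]
    exact le_csSup (hbdd t) ⟨r, ⟨hr, hrt⟩, rfl⟩
  have hP_le : ∀ t M, 0 ≤ M → (∀ r ∈ S, r ≤ t → p r ≤ M) → P t ≤ M := by
    intro t M hM h
    rw [hPdef]
    show sSup (p '' {r | r ∈ S ∧ r ≤ t}) ≤ M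
    by_cases hne : (p '' {r | r ∈ S ∧ r ≤ t}).Nonempty
    · exact csSup_le hne (by rintro _ ⟨r, hr, rfl⟩; exact h r hr.1 hr.2)
    · rw [Set.not_nonempty_iff_eq_empty.1 hne, Real.sSup_empty]
      exact hM
  have hP0 : ∀ t, 0 ≤ P t := by
    intro t
    by_cases hne : (p '' {r | r ∈ S ∧ r ≤ t}).Nonempty
    · obtain ⟨_, ⟨r, hr, rfl⟩⟩ := hne
      exact (hp0 r hr.1).trans (hle_P t r hr.1 hr.2)
    · rw [hPdef]
      show 0 ≤ sSup (p '' {r | r ∈ S ∧ r ≤ t})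
      rw [Set.not_nonempty_iff_eq_empty.1 hne, Real.sSup_empty]
  have hPB : ∀ t, P t ≤ B := fun t => hP_le t B hB fun r hr _ => hpB r hr
  have hPmono : Monotone P := fun t t' htt' =>
    hP_le t (P t') (hP0 t') fun r hr hrt => hle_P t' r hr (hrt.trans htt')
  have hPmeas : Measurable P := hPmono.measurable
  have hPint : ∀ a b, IntegrableOn P (Ioc a b) := fun a b =>
    Measure.integrableOn_of_bounded (M := B) (by simp [Real.volume_Ioc]) hPmeas.aestronglyMeasurable
      (Eventually.of_forall fun t => by rw [Real.norm_eq_abs, abs_of_nonneg (hP0 t)]; exact hPB t)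
  -- ### the fast energy: exponential-envelope bound at every good time
  have hq_env : ∀ r ∈ S, q r ≤ 4 * η ^ 2 / lam ^ 2 * P r + q₀ * Real.exp (-(lam / 2) * r) := by
    intro r hr
    have hr0 : 0 < r := (hSsub hr).1
    have hrT : r < T := (hSsub hr).2
    have hsubT : Ioc 0 r ⊆ Ioo 0 T := fun x hx => ⟨hx.1, hx.2.trans_lt hrT⟩
    have hSrsub : S ∩ Ioc 0 r ⊆ Ioc 0 r := inter_subset_right
    have hSrae : ∀ᵐ x ∂(volume.restrict (Ioc 0 r)), x ∈ S ∩ Ioc 0 r := by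
      filter_upwards [ae_restrict_of_ae_restrict_of_subset hsubT hS, ae_restrict_mem measurableSet_Ioc] with x hx hx'
      exact ⟨hx, hx'⟩
    obtain ⟨K, hK⟩ : ∃ K : ℝ, K = 2 * η ^ 2 / lam * P r := ⟨_, rfl⟩
    have hK0 : 0 ≤ K := by rw [hK]; exact mul_nonneg (by positivity) (hP0 r)
    -- the pointwise bound `−φ − λq ≤ K − (λ/2) q` a.e. on `(0, r]`
    have hY : ∀ᵐ x ∂(volume : Measure ℝ), x ∈ Ioc 0 r → -φ x - lam * q x ≤ K - lam / 2 * q x := by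
      filter_upwards [hS', hφ'] with x hxS hxφ hx
      have hxT : x ∈ Ioo 0 T := hsubT hx
      have hxs : x ∈ S := hxS hxT
      have h1 := hxφ hxT
      have h2 := two_mul_sqrt_mul_le hη hlam (hp0 x hxs) (hq0 x hxs)
      have h3 : 2 * η ^ 2 / lam * p x ≤ K := by
        rw [hK]
        exact mul_le_mul_of_nonneg_left (hle_P r x hxs hx.2) (by positivity)
      have h4 : -φ x ≤ |φ x| := neg_le_abs _
      linarith
    have hIcmp : ∀ s t, 0 ≤ s → t ≤ r →
        ∫ x in Ioc s t, (-φ x - lam * q x) ≤ ∫ x in Ioc s t, (K - lam / 2 * q x) := by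
      intro s t hs ht
      have hsub : Ioc s t ⊆ Ioc 0 r := fun x hx => ⟨hs.trans_lt hx.1, hx.2.trans ht⟩
      have hsub' : Ioc s t ⊆ Ioo 0 T := hsub.trans hsubT
      refine setIntegral_mono_ae_restrict ((hφi.mono_set hsub').neg.sub ((hqi.mono_set hsub').const_mul lam))
        ((integrableOn_const (by simp [Real.volume_Ioc])).sub ((hqi.mono_set hsub').const_mul (lam / 2))) ?_
      refine (ae_restrict_iff' measurableSet_Ioc).2 ?_
      filter_upwards [hY] with x hx hxm
      exact hx (hsub hxm)
    have henv := le_envelope_of_two_point_setIntegral_le (u := q) (S := S ∩ Ioc 0 r) (T := r) (K := K)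
      (lam := lam / 2) (c := q₀) (u₀ := q₀) (by positivity) hK0 hq₀ hSrsub hSrae (fun x hx => hq0 x hx.1)
      (hqi.mono_set hsubT)
      (by have : 0 ≤ K / (lam / 2) := div_nonneg hK0 (by positivity); linarith)
      (fun t ht => (hqinit t ht.1).trans (hIcmp 0 t le_rfl ht.2.2))
      (fun s hs t ht hst => (hq2 s hs.1 t ht.1 hst).trans (hIcmp s t hs.2.1.le ht.2.2))
      r ⟨hr, hr0, le_rfl⟩
    have e1 : K / (lam / 2) = 4 * η ^ 2 / lam ^ 2 * P r := by
      rw [hK]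
      field_simp
      ring
    rw [e1] at henv
    exact henv
  -- square-root form: `√q ≤ (2η/λ)√P + √q₀ e^{−λx/4}`
  have hsqrt_q : ∀ x ∈ S, Real.sqrt (q x) ≤ 2 * η / lam * Real.sqrt (P x) + Real.sqrt q₀ * Real.exp (-(lam / 4) * x) := by
    intro x hx
    refine sqrt_le_add_of_le_sq_add_sq (by positivity) (by positivity) ?_
    have h1 := hq_env x hx
    have hPx : Real.sqrt (P x) ^ 2 = P x := Real.sq_sqrt (hP0 x)
    have hq0' : Real.sqrt q₀ ^ 2 = q₀ := Real.sq_sqrt hq₀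
    have hexp : Real.exp (-(lam / 4) * x) ^ 2 = Real.exp (-(lam / 2) * x) := by
      rw [sq, ← Real.exp_add]
      congr 1
      ring
    rw [mul_pow, mul_pow, hPx, hq0', hexp]
    have e : (2 * η / lam) ^ 2 = 4 * η ^ 2 / lam ^ 2 := by ring
    rw [e]
    exact h1
  -- ### the slow energy: the a.e. bound on the flux in terms of the running supremum
  have hφP : ∀ t ∈ S, ∀ᵐ x ∂(volume : Measure ℝ), x ∈ Ioc 0 t →
      |φ x| ≤ 4 * η ^ 2 / lam * P x + 2 * η * Real.sqrt q₀ * Real.sqrt (P t) * Real.exp (-(lam / 4) * x) := by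
    intro t ht
    have htT := (hSsub ht).2
    filter_upwards [hS', hφ'] with x hxS hxφ hx
    have hxT : x ∈ Ioo 0 T := ⟨hx.1, hx.2.trans_lt htT⟩
    have hxs := hxS hxT
    have h1 := hxφ hxT
    have h2 : Real.sqrt (p x * q x) ≤ Real.sqrt (P x) * Real.sqrt (q x) := by
      rw [← Real.sqrt_mul (hP0 x)]
      exact Real.sqrt_le_sqrt (mul_le_mul_of_nonneg_right (hle_P x x hxs le_rfl) (hq0 x hxs))
    have h3 := hsqrt_q x hxs
    have hPxt : Real.sqrt (P x) ≤ Real.sqrt (P t) := Real.sqrt_le_sqrt (hPmono hx.2)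
    have hsPx : 0 ≤ Real.sqrt (P x) := Real.sqrt_nonneg _
    have hPx : Real.sqrt (P x) * Real.sqrt (P x) = P x := Real.mul_self_sqrt (hP0 x)
    have h4 : Real.sqrt (P x) * Real.sqrt (q x) ≤
        Real.sqrt (P x) * (2 * η / lam * Real.sqrt (P x) + Real.sqrt q₀ * Real.exp (-(lam / 4) * x)) :=
      mul_le_mul_of_nonneg_left h3 hsPx
    have h5 : Real.sqrt q₀ * Real.sqrt (P x) * Real.exp (-(lam / 4) * x) ≤
        Real.sqrt q₀ * Real.sqrt (P t) * Real.exp (-(lam / 4) * x) :=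
      mul_le_mul_of_nonneg_right (mul_le_mul_of_nonneg_left hPxt (Real.sqrt_nonneg _)) (Real.exp_pos _).le
    have e : 2 * η * (Real.sqrt (P x) * (2 * η / lam * Real.sqrt (P x) + Real.sqrt q₀ * Real.exp (-(lam / 4) * x))) =
        4 * η ^ 2 / lam * (Real.sqrt (P x) * Real.sqrt (P x)) +
          2 * η * (Real.sqrt q₀ * Real.sqrt (P x) * Real.exp (-(lam / 4) * x)) := by ring
    calc |φ x| ≤ 2 * η * Real.sqrt (p x * q x) := h1
      _ ≤ 2 * η * (Real.sqrt (P x) * Real.sqrt (q x)) := mul_le_mul_of_nonneg_left h2 (by positivity)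
      _ ≤ 2 * η * (Real.sqrt (P x) * (2 * η / lam * Real.sqrt (P x) + Real.sqrt q₀ * Real.exp (-(lam / 4) * x))) :=
          mul_le_mul_of_nonneg_left h4 (by positivity)
      _ = 4 * η ^ 2 / lam * P x + 2 * η * (Real.sqrt q₀ * Real.sqrt (P x) * Real.exp (-(lam / 4) * x)) := by
          rw [e, hPx]
      _ ≤ 4 * η ^ 2 / lam * P x + 2 * η * (Real.sqrt q₀ * Real.sqrt (P t) * Real.exp (-(lam / 4) * x)) := by
          have := mul_le_mul_of_nonneg_left h5 (show (0:ℝ) ≤ 2 * η by positivity)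
          linarith
      _ = _ := by ring
  -- the bound `p(t') ≤ (4η²/λ) ∫_{(0,t]} P + (8η√q₀/λ) √(P t)` for `t' ≤ t` in `S`
  have hp_bound : ∀ t ∈ S, ∀ t' ∈ S, t' ≤ t →
      p t' ≤ 4 * η ^ 2 / lam * (∫ x in Ioc 0 t, P x) + 8 * η * Real.sqrt q₀ / lam * Real.sqrt (P t) := by
    intro t ht t' ht' htt
    have ht0 : 0 < t := (hSsub ht).1
    have htT : t < T := (hSsub ht).2
    obtain ⟨g, hg⟩ : ∃ g : ℝ → ℝ, g = fun x =>
        4 * η ^ 2 / lam * P x + 2 * η * Real.sqrt q₀ * Real.sqrt (P t) * Real.exp (-(lam / 4) * x) := ⟨_, rfl⟩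
    have hcont : Continuous fun x : ℝ => 2 * η * Real.sqrt q₀ * Real.sqrt (P t) * Real.exp (-(lam / 4) * x) :=
      continuous_const.mul (Real.continuous_exp.comp (continuous_const.mul continuous_id))
    have hgi : ∀ a b', IntegrableOn g (Ioc a b') := fun a b' => by
      rw [hg]
      exact ((hPint a b').const_mul _).add hcont.integrableOn_Ioc
    have hg0 : ∀ x, 0 ≤ g x := fun x => by
      rw [hg]
      have := hP0 x
      positivity
    have h1 : p t' ≤ ∫ x in Ioc 0 t', g x := by
      refine (hp t' ht').trans ?_
      have hsub : Ioc 0 t' ⊆ Ioo 0 T := fun x hx => ⟨hx.1, hx.2.trans_lt (htt.trans_lt htT)⟩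
      refine setIntegral_mono_ae_restrict (hφi.mono_set hsub) (hgi 0 t') ?_
      refine (ae_restrict_iff' measurableSet_Ioc).2 ?_
      filter_upwards [hφP t ht] with x hx hxm
      rw [hg]
      exact (le_abs_self _).trans (hx ⟨hxm.1, hxm.2.trans htt⟩)
    have h2 : ∫ x in Ioc 0 t', g x ≤ ∫ x in Ioc 0 t, g x :=
      setIntegral_mono_set (hgi 0 t) (Eventually.of_forall hg0) (Ioc_subset_Ioc le_rfl htt).eventuallyLE
    have h3 : ∫ x in Ioc 0 t, g x = 4 * η ^ 2 / lam * (∫ x in Ioc 0 t, P x) +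
        2 * η * Real.sqrt q₀ * Real.sqrt (P t) * ∫ x in Ioc 0 t, Real.exp (-(lam / 4) * x) := by
      rw [hg]
      simp only
      rw [integral_add ((hPint 0 t).const_mul _) hcont.integrableOn_Ioc, integral_const_mul, integral_const_mul]
    have h4 := setIntegral_Ioc_exp_neg_quarter_le hlam ht0.le
    have h5 : 2 * η * Real.sqrt q₀ * Real.sqrt (P t) * (∫ x in Ioc 0 t, Real.exp (-(lam / 4) * x)) ≤
        2 * η * Real.sqrt q₀ * Real.sqrt (P t) * (4 / lam) := mul_le_mul_of_nonneg_left h4 (by positivity)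
    have e : 2 * η * Real.sqrt q₀ * Real.sqrt (P t) * (4 / lam) = 8 * η * Real.sqrt q₀ / lam * Real.sqrt (P t) := by ring
    linarith
  -- hence `P t ≤ a + b ∫_{(0,t]} P` on `S` (Young), and then on `[0,T]`
  have hPS : ∀ t ∈ S, P t ≤ 64 * η ^ 2 / lam ^ 2 * q₀ + 8 * η ^ 2 / lam * ∫ x in Ioc 0 t, P x := by
    intro t ht
    have hI0 : 0 ≤ ∫ x in Ioc 0 t, P x := setIntegral_nonneg measurableSet_Ioc fun x _ => hP0 x
    have hsup : P t ≤ 4 * η ^ 2 / lam * (∫ x in Ioc 0 t, P x) + 8 * η * Real.sqrt q₀ / lam * Real.sqrt (P t) :=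
      hP_le t _ (by positivity) fun r hr hrt => hp_bound t ht r hr hrt
    have hy : 8 * η * Real.sqrt q₀ / lam * Real.sqrt (P t) ≤ P t / 2 + 32 * η ^ 2 / lam ^ 2 * q₀ := by
      have hu : Real.sqrt (P t) ^ 2 = P t := Real.sq_sqrt (hP0 t)
      have hv : Real.sqrt q₀ ^ 2 = q₀ := Real.sq_sqrt hq₀
      have hsq := sq_nonneg (Real.sqrt (P t) - 8 * η * Real.sqrt q₀ / lam)
      have e : (Real.sqrt (P t) - 8 * η * Real.sqrt q₀ / lam) ^ 2 =
          Real.sqrt (P t) ^ 2 - 2 * (8 * η * Real.sqrt q₀ / lam * Real.sqrt (P t)) +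
            64 * η ^ 2 / lam ^ 2 * Real.sqrt q₀ ^ 2 := by ring
      rw [e, hu, hv] at hsq
      have h64 : 64 * η ^ 2 / lam ^ 2 * q₀ = 2 * (32 * η ^ 2 / lam ^ 2 * q₀) := by ring
      linarith
    have h64 : 64 * η ^ 2 / lam ^ 2 * q₀ = 2 * (32 * η ^ 2 / lam ^ 2 * q₀) := by ring
    have h8 : 8 * η ^ 2 / lam * (∫ x in Ioc 0 t, P x) = 2 * (4 * η ^ 2 / lam * ∫ x in Ioc 0 t, P x) := by ring
    linarith
  have hPall : ∀ τ ∈ Icc 0 T, P τ ≤ 64 * η ^ 2 / lam ^ 2 * q₀ + 8 * η ^ 2 / lam * ∫ x in Ioc 0 τ, P x := by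
    intro τ hτ
    have hI0 : 0 ≤ ∫ x in Ioc 0 τ, P x := setIntegral_nonneg measurableSet_Ioc fun x _ => hP0 x
    refine hP_le τ _ (by positivity) fun r hr hrτ => ?_
    have h1 : p r ≤ P r := hle_P r r hr le_rfl
    have h2 := hPS r hr
    have h3 : ∫ x in Ioc 0 r, P x ≤ ∫ x in Ioc 0 τ, P x :=
      setIntegral_mono_set (hPint 0 τ) (Eventually.of_forall hP0) (Ioc_subset_Ioc le_rfl hrτ).eventuallyLE
    have h4 : 8 * η ^ 2 / lam * (∫ x in Ioc 0 r, P x) ≤ 8 * η ^ 2 / lam * ∫ x in Ioc 0 τ, P x :=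
      mul_le_mul_of_nonneg_left h3 (by positivity)
    linarith
  -- ### Grönwall on the continuous primitive of the running supremum
  obtain ⟨a, ha⟩ : ∃ a : ℝ, a = 64 * η ^ 2 / lam ^ 2 * q₀ := ⟨_, rfl⟩
  obtain ⟨b, hb⟩ : ∃ b : ℝ, b = 8 * η ^ 2 / lam := ⟨_, rfl⟩
  have ha0 : 0 ≤ a := by rw [ha]; positivity
  have hb0 : 0 ≤ b := by rw [hb]; positivity
  have hPii : ∀ c d : ℝ, IntervalIntegrable P volume c d := fun c d =>
    intervalIntegrable_iff.2 (hPint _ _)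
  obtain ⟨G, hG⟩ : ∃ G : ℝ → ℝ, G = fun τ => a + b * ∫ x in (0:ℝ)..τ, P x := ⟨_, rfl⟩
  have hGcont : Continuous G := by
    rw [hG]
    exact continuous_const.add (continuous_const.mul (intervalIntegral.continuous_primitive hPii 0))
  have hPG : ∀ τ ∈ Icc 0 T, P τ ≤ G τ := by
    intro τ hτ
    rw [hG]
    simp only
    rw [intervalIntegral.integral_of_le hτ.1, ha, hb]
    exact hPall τ hτ
  have hGle : ∀ τ ∈ Icc 0 T, G τ ≤ a + ∫ s in (0:ℝ)..τ, b * G s := by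
    intro τ hτ
    have hmono : ∫ x in (0:ℝ)..τ, P x ≤ ∫ x in (0:ℝ)..τ, G x :=
      intervalIntegral.integral_mono_on hτ.1 (hPii 0 τ) (hGcont.intervalIntegrable 0 τ)
        fun x hx => hPG x ⟨hx.1, hx.2.trans hτ.2⟩
    have hGτ : G τ = a + b * ∫ x in (0:ℝ)..τ, P x := by rw [hG]
    rw [intervalIntegral.integral_const_mul, hGτ]
    have := mul_le_mul_of_nonneg_left hmono hb0
    linarith
  have hgron := gronwall_integral_le_on (a := fun _ => b) (g := G) (h := fun _ => a) (T := T)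
    continuous_const hGcont (fun _ => hb0) monotoneOn_const hGle
  -- ### conclusion
  intro t ht
  have ht0 : 0 < t := (hSsub ht).1
  have htT : t < T := (hSsub ht).2
  have h1 : p t ≤ P t := hle_P t t ht le_rfl
  have h2 : P t ≤ G t := hPG t ⟨ht0.le, htT.le⟩
  have h3 := hgron t ⟨ht0.le, htT.le⟩
  rw [intervalIntegral.integral_const, smul_eq_mul, sub_zero] at h3
  have e : a * Real.exp (t * b) = 64 * η ^ 2 / lam ^ 2 * Real.exp (8 * η ^ 2 / lam * t) * q₀ := by
    rw [ha, hb, mul_comm t]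
    ring
  linarith [h3, e.le, e.ge]

end Literature.Analysis.ODE

end
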